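import Mathlib
import HarnessLib

/-!
# Variation of parameters for `u'' = q u`: differentiation rules, the exact inverse-square pair
# `x^{-ℓ}, x^{ℓ+1}`, and tail-integral bounds on `(z, ∞)`

Analysis/ODE support file (everything proved, no definitions). Three groups of elementary lemmas used
to build solutions of one-dimensional Schrödinger equations `u'' = V u` (and of `−u'' + Vu = f`) by
variation of parameters on a right half-line:

* `hasDerivAt_varParams`, `hasDerivAt_varParams_deriv`: if `u = φ₁ α + φ₂ β` with
  `α' = −κ φ₂ h`, `β' = κ φ₁ h`, `φᵢ'' = q φᵢ` and `κ(φ₁φ₂' − φ₁'φ₂) = 1`, then `u' = φ₁'α + φ₂'β` and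
  `u'' = q u + h` (pointwise `HasDerivAt` statements);
* `hasDerivAt_deriv_zpow`, `wronskian_zpow`: `x^m` solves `φ'' = m(m−1)x⁻²φ`, and the pair
  `x^{-ℓ}, x^{ℓ+1}` of solutions of `φ'' = ℓ(ℓ+1)x⁻²φ` has Wronskian `2ℓ+1`;
* `abs_setIntegral_Ioi_mul_le`, `abs_setIntegral_Ioi_div_pow_le`: for `|φ| ≤ C` and `y|W y|`
  integrable on `(x₀,∞)`, `x₀ ≥ 1`: `|∫_{y>z} yWφ| ≤ C∫_{y>z} y|W|` and
  `z^{2ℓ+1}|∫_{y>z} Wφ/(max y 1)^{2ℓ}| ≤ C∫_{y>z} y|W|` (`z ≥ x₀`).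

Standard calculus (e.g. P. Hartman, *Ordinary Differential Equations*, Ch. XI §9, Volterra/Jost
constructions); folklore. Use: `VolterraRecessiveInverseSquare.lean` (recessive solution `~x^{-ℓ}` of
`u'' = (ℓ(ℓ+1)/x² + W)u`) and the true far-side kernel of the Regge–Wheeler channel estimate
`FixedModeChannels` (route PhotonSphereChannels, stmt-FinalStateConjecture-10048).
-/

noncomputable section

namespace Literature.Analysis.ODE

open MeasureTheory Set Filter Topology intervalIntegral

/-! ### Variation of parameters: differentiation rules -/

/-- **Variation of parameters, first derivative.** If `α' = −κ φ₂ h` and `β' = κ φ₁ h` at `x` then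
`(φ₁ α + φ₂ β)' = φ₁' α + φ₂' β` at `x` (the terms with `α', β'` cancel). [folklore] -/
theorem hasDerivAt_varParams {φ₁ φ₂ α β h : ℝ → ℝ} {κ x : ℝ} (h1 : DifferentiableAt ℝ φ₁ x)
    (h2 : DifferentiableAt ℝ φ₂ x) (hα : HasDerivAt α (-(κ * φ₂ x * h x)) x)
    (hβ : HasDerivAt β (κ * φ₁ x * h x) x) :
    HasDerivAt (fun y => φ₁ y * α y + φ₂ y * β y) (deriv φ₁ x * α x + deriv φ₂ x * β x) x := by
  have e := (h1.hasDerivAt.mul hα).add (h2.hasDerivAt.mul hβ)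
  refine e.congr_deriv ?_
  ring

/-- **Variation of parameters, second derivative.** If moreover `φᵢ'' = q φᵢ` at `x` and the
Wronskian is normalised by `κ (φ₁ φ₂' − φ₁' φ₂) = 1`, then
`(φ₁' α + φ₂' β)' = q (φ₁ α + φ₂ β) + h` at `x`. [folklore] -/
theorem hasDerivAt_varParams_deriv {φ₁ φ₂ α β h : ℝ → ℝ} {κ q x : ℝ}
    (h1 : HasDerivAt (deriv φ₁) (q * φ₁ x) x) (h2 : HasDerivAt (deriv φ₂) (q * φ₂ x) x)
    (hα : HasDerivAt α (-(κ * φ₂ x * h x)) x) (hβ : HasDerivAt β (κ * φ₁ x * h x) x)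
    (hκ : κ * (φ₁ x * deriv φ₂ x - deriv φ₁ x * φ₂ x) = 1) :
    HasDerivAt (fun y => deriv φ₁ y * α y + deriv φ₂ y * β y)
      (q * (φ₁ x * α x + φ₂ x * β x) + h x) x := by
  have e := (h1.mul hα).add (h2.mul hβ)
  refine e.congr_deriv ?_
  linear_combination h x * hκ

/-! ### The exact solutions `x^{-ℓ}`, `x^{ℓ+1}` of `φ'' = ℓ(ℓ+1)x⁻² φ` -/

/-- `deriv (x ↦ x^m) = m x^{m-1}` and its derivative at `x ≠ 0`: `(x^m)'' = (m(m-1)/x²)·x^m`.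
[folklore] -/
theorem hasDerivAt_deriv_zpow (m : ℤ) {x : ℝ} (hx : x ≠ 0) :
    HasDerivAt (deriv fun y : ℝ => y ^ m) ((m : ℝ) * (m - 1) / x ^ 2 * x ^ m) x := by
  rw [deriv_zpow']
  have h := (hasDerivAt_zpow (m - 1) x (Or.inl hx)).const_mul (m : ℝ)
  refine h.congr_deriv ?_
  rw [show m - 1 - 1 = m - 2 by ring, zpow_sub₀ hx m 2]
  push_cast
  field_simp

/-- The Wronskian of `x^{-ℓ}` and `x^{ℓ+1}` is `2ℓ + 1` (`x ≠ 0`). [folklore] -/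
theorem wronskian_zpow (ℓ : ℕ) {x : ℝ} (hx : x ≠ 0) :
    (1 / (2 * (ℓ : ℝ) + 1)) * (x ^ (-(ℓ : ℤ)) * deriv (fun y : ℝ => y ^ ((ℓ : ℤ) + 1)) x
      - deriv (fun y : ℝ => y ^ (-(ℓ : ℤ))) x * x ^ ((ℓ : ℤ) + 1)) = 1 := by
  rw [deriv_zpow, deriv_zpow]
  have e1 : x ^ (-(ℓ : ℤ)) * x ^ ((ℓ : ℤ) + 1 - 1) = 1 := by
    rw [← zpow_add₀ hx]; simp
  have e2 : x ^ (-(ℓ : ℤ) - 1) * x ^ ((ℓ : ℤ) + 1) = 1 := by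
    rw [← zpow_add₀ hx]; ring_nf; simp
  have hℓ : (2 * (ℓ : ℝ) + 1) ≠ 0 := by positivity
  push_cast
  field_simp
  linear_combination (↑ℓ + 1) * e1 + (↑ℓ) * e2

/-! ### Tail-integral bounds on `(z, ∞)` -/

section Tail

variable {W : ℝ → ℝ} {x₀ : ℝ}

/-- Tail bound: for `z ≥ x₀ ≥ 1`, continuous `φ` with `|φ| ≤ C`, and `y|W y|` integrable on `(x₀, ∞)`:
`|∫_{y>z} y W(y) φ(y) dy| ≤ C ∫_{y>z} y|W y| dy`. [folklore] -/
theorem abs_setIntegral_Ioi_mul_le (hW : Continuous W) (hx₀ : 1 ≤ x₀)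
    (hWi : IntegrableOn (fun y => y * |W y|) (Ioi x₀)) {φ : ℝ → ℝ} (hφ : Continuous φ) {C : ℝ}
    (hC : ∀ y, |φ y| ≤ C) {z : ℝ} (hz : x₀ ≤ z) :
    IntegrableOn (fun y => y * W y * φ y) (Ioi z) ∧
      |∫ y in Ioi z, y * W y * φ y| ≤ C * ∫ y in Ioi z, y * |W y| := by
  have hC0 : 0 ≤ C := (abs_nonneg _).trans (hC 0)
  have hWz : IntegrableOn (fun y => y * |W y|) (Ioi z) := hWi.mono_set (Ioi_subset_Ioi hz)
  have hbd : ∀ y ∈ Ioi z, |y * W y * φ y| ≤ C * (y * |W y|) := by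
    intro y hy
    have hy0 : 0 ≤ y := by linarith [mem_Ioi.1 hy]
    rw [abs_mul, abs_mul, abs_of_nonneg hy0]
    calc y * |W y| * |φ y| ≤ y * |W y| * C := by gcongr; exact hC y
      _ = C * (y * |W y|) := by ring
  have hi : IntegrableOn (fun y => y * W y * φ y) (Ioi z) := by
    refine Integrable.mono' (hWz.const_mul C) ?_ ?_
    · exact ((continuous_id.mul hW).mul hφ).aestronglyMeasurable
    · exact (ae_restrict_iff' measurableSet_Ioi).2 (Eventually.of_forall fun y hy => by
        rw [Real.norm_eq_abs]; exact hbd y hy)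
  refine ⟨hi, ?_⟩
  calc |∫ y in Ioi z, y * W y * φ y| ≤ ∫ y in Ioi z, |y * W y * φ y| := abs_integral_le_integral_abs
    _ ≤ ∫ y in Ioi z, C * (y * |W y|) :=
        setIntegral_mono_on hi.abs (hWz.const_mul C) measurableSet_Ioi hbd
    _ = C * ∫ y in Ioi z, y * |W y| := MeasureTheory.integral_const_mul _ _

/-- Tail bound with the inverse power: for `z ≥ x₀ ≥ 1`, continuous `φ` with `|φ| ≤ C`:
`z^{2ℓ+1} |∫_{y>z} W(y) φ(y) / (max y 1)^{2ℓ} dy| ≤ C ∫_{y>z} y|W y| dy` (the `max` keeps the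
integrand continuous on `ℝ`; on `y > z ≥ 1` it is `W φ / y^{2ℓ}`). [folklore] -/
theorem abs_setIntegral_Ioi_div_pow_le (hW : Continuous W) (hx₀ : 1 ≤ x₀)
    (hWi : IntegrableOn (fun y => y * |W y|) (Ioi x₀)) {φ : ℝ → ℝ} (hφ : Continuous φ) {C : ℝ}
    (hC : ∀ y, |φ y| ≤ C) (ℓ : ℕ) {z : ℝ} (hz : x₀ ≤ z) :
    IntegrableOn (fun y => W y * φ y / (max y 1) ^ (2 * ℓ)) (Ioi z) ∧
      z ^ (2 * ℓ + 1) * |∫ y in Ioi z, W y * φ y / (max y 1) ^ (2 * ℓ)|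
        ≤ C * ∫ y in Ioi z, y * |W y| := by
  have hC0 : 0 ≤ C := (abs_nonneg _).trans (hC 0)
  have hz0 : 0 < z := by linarith
  have hzp : 0 < z ^ (2 * ℓ + 1) := pow_pos hz0 _
  have hWz : IntegrableOn (fun y => y * |W y|) (Ioi z) := hWi.mono_set (Ioi_subset_Ioi hz)
  have hbd : ∀ y ∈ Ioi z, |W y * φ y / (max y 1) ^ (2 * ℓ)| ≤ C / z ^ (2 * ℓ + 1) * (y * |W y|) := by
    intro y hy
    have hzy : z < y := mem_Ioi.1 hy
    have hy0 : 0 < y := hz0.trans hzy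
    have hy1 : max y 1 = y := max_eq_left (by linarith)
    rw [hy1]
    have hyp : 0 < y ^ (2 * ℓ) := pow_pos hy0 _
    rw [abs_div, abs_mul, abs_of_pos hyp, div_le_iff₀ hyp]
    have hpow : z ^ (2 * ℓ + 1) ≤ y ^ (2 * ℓ) * y := by
      rw [← pow_succ]; exact pow_le_pow_left₀ hz0.le hzy.le _
    calc |W y| * |φ y| ≤ |W y| * C := by gcongr; exact hC y
      _ = C / z ^ (2 * ℓ + 1) * |W y| * z ^ (2 * ℓ + 1) := by field_simp
      _ ≤ C / z ^ (2 * ℓ + 1) * |W y| * (y ^ (2 * ℓ) * y) := by gcongr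
      _ = C / z ^ (2 * ℓ + 1) * (y * |W y|) * y ^ (2 * ℓ) := by ring
  have hcont : Continuous fun y => W y * φ y / (max y 1) ^ (2 * ℓ) :=
    (hW.mul hφ).div ((continuous_id.max continuous_const).pow _) fun y =>
      pow_ne_zero _ (lt_max_of_lt_right one_pos).ne'
  have hi : IntegrableOn (fun y => W y * φ y / (max y 1) ^ (2 * ℓ)) (Ioi z) := by
    refine Integrable.mono' (hWz.const_mul (C / z ^ (2 * ℓ + 1))) hcont.aestronglyMeasurable ?_
    exact (ae_restrict_iff' measurableSet_Ioi).2 (Eventually.of_forall fun y hy => by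
      rw [Real.norm_eq_abs]; exact hbd y hy)
  refine ⟨hi, ?_⟩
  have key : |∫ y in Ioi z, W y * φ y / (max y 1) ^ (2 * ℓ)|
      ≤ C / z ^ (2 * ℓ + 1) * ∫ y in Ioi z, y * |W y| :=
    calc |∫ y in Ioi z, W y * φ y / (max y 1) ^ (2 * ℓ)|
        ≤ ∫ y in Ioi z, |W y * φ y / (max y 1) ^ (2 * ℓ)| := abs_integral_le_integral_abs
      _ ≤ ∫ y in Ioi z, C / z ^ (2 * ℓ + 1) * (y * |W y|) :=
          setIntegral_mono_on hi.abs (hWz.const_mul _) measurableSet_Ioi hbd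
      _ = C / z ^ (2 * ℓ + 1) * ∫ y in Ioi z, y * |W y| := MeasureTheory.integral_const_mul _ _
  calc z ^ (2 * ℓ + 1) * |∫ y in Ioi z, W y * φ y / (max y 1) ^ (2 * ℓ)|
      ≤ z ^ (2 * ℓ + 1) * (C / z ^ (2 * ℓ + 1) * ∫ y in Ioi z, y * |W y|) := by gcongr
    _ = C * ∫ y in Ioi z, y * |W y| := by field_simp

end Tail

end Literature.Analysis.ODE
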